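import Literature.NumberTheory.EllipticCurves.IwasawaTowerTorsionProofs
import Literature.NumberTheory.EllipticCurves.ZpExtensionProofs
import Literature.NumberTheory.EllipticCurves.HeegnerPoints
import HarnessLib

/-!
# Torsion in the anticyclotomic tower, I: cyclic layers and the dihedral set-up

Seat `bsd-schneider-door-c5` (cell `bsd-schneider-ideate`), gen 4; route `SchneiderFreeAdditiveX3`, crux
`AnticycControlAdditiveK` (stmt-BirchSwinnertonDyer-19295, skeleton v3-K, atom (KER-res) /
`stub_kerRes`). First half of the proof that **`E(K_∞^{ac})[p^∞] = E(K)[p^∞]`** for every `E/ℚ`,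
odd `p`, imaginary quadratic `K` with `μ_p(K) = 1` and anticyclotomic `ℤ_p`-extension `K_∞/K`
(completed in `SchneiderFreeAdditiveX3AnticyclotomicTowerTorsion.lean`, which see for the framing).
Contents (all elementary, no cite-only fact):

* §1 layers of a `p`-primary subgroup `B` of an abelian group with `#B[p] ≤ p` are cyclic
  (`card_layer_succ_le`, `card_layer_le_pow`, `isAddCyclic_layer`);
* §2 on a stable cyclic subgroup of a `G`-module any two elements of `G` commute
  (`smul_smul_comm_of_isAddCyclic`);
* §3 the dihedral set-up for `[K : ℚ] = 2`: conjugates of restrictions are restrictions, the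
  anticyclotomic relation `σ'σ ∈ ker κ` when `res σ' = ρ (res σ) ρ⁻¹`, `ρ ∉ Γ_K`, and normality of
  `res(ker κ)` in `Γ_ℚ` (`exists_absGaloisRestrict_eq_conj`, `mul_mem_kerSubgroup_of_isAnticyclotomic`,
  `exists_mem_kerSubgroup_absGaloisRestrict_eq_conj`);
* §4 over `ℚ̄`: `Γ_ℚ`-stability of the points fixed by `res(ker κ)`, the `p`-power order of `res σ`
  on a finite stable set fixed by `res(ker κ)` (`ZpExtension.isPGroup_range_of_kerSubgroup_le`), and
  **Case A**: on a finite CYCLIC `Γ_ℚ`-stable subgroup fixed by `res(ker κ)`, `Γ_K` acts trivially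
  (`absGaloisRestrict_smul_eq_of_isAddCyclic`; `p` odd, `K` imaginary quadratic).

Proofs only (no definition, no named fact, no `sorry`); closes nothing by itself; BSD is not
advanced by any of this.

## References

* [GreenbergLNM1716] R. Greenberg, *Iwasawa theory for elliptic curves*, LNM 1716 (1999), §1 p. 62,
  §3 Lemma 3.1 (p. 86), proof of Prop. 4.8 (p. 109: the `p`-group fixed-point principle).
* [Brink2007] D. Brink, *Prime decomposition in the anti-cyclotomic extension*, Math. Comp. 76
  (2007), §II Prop. 1 (`K^{anti}` is pro-dihedral over `ℚ`).
-/

noncomputable section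

open scoped Classical

namespace Summit.BirchSwinnertonDyer.BirchSwinnertonDyer.Theorems.SchneiderFreeAdditiveX3

open WeierstrassCurve Field Literature.NumberTheory.EllipticCurves
  Literature.NumberTheory.GaloisRepresentations

set_option linter.dupNamespace false

/-! ## §1. Layers of a `p`-primary subgroup with at most `p` points of order `p` are cyclic -/

section PGroupCounting

variable {A : Type*} [AddCommGroup A] {B : AddSubgroup A} {p : ℕ} {V : ℕ → AddSubgroup A}

/-- Layer bound `#V_{n+1} ≤ #V_n · #V_1` for the layers `V_n = B[p^n]` of a subgroup `B` of an
abelian group: the map `v ↦ p^n • v : V_{n+1} → V_1` has kernel inside `V_n`. [folklore] -/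
theorem card_layer_succ_le (hV : ∀ n x, x ∈ V n ↔ x ∈ B ∧ p ^ n • x = 0)
    (hfin : ∀ n, Finite (V n)) (n : ℕ) :
    Nat.card (V (n + 1)) ≤ Nat.card (V n) * Nat.card (V 1) := by
  haveI := hfin n; haveI := hfin 1; haveI := hfin (n + 1)
  let f : V (n + 1) →+ A :=
    { toFun := fun v ↦ p ^ n • (v : A)
      map_zero' := by rw [ZeroMemClass.coe_zero, smul_zero]
      map_add' := fun v w ↦ by rw [AddSubgroup.coe_add, smul_add] }
  have hf_range : ∀ v : V (n + 1), f v ∈ V 1 := by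
    intro v
    obtain ⟨hvB, hvp⟩ := (hV (n + 1) v).mp v.2
    refine (hV 1 _).mpr ⟨B.nsmul_mem hvB _, ?_⟩
    change p ^ 1 • p ^ n • (v : A) = 0
    rw [pow_one, smul_smul, ← pow_succ', hvp]
  have hf_ker : ∀ v : V (n + 1), f v = 0 → (v : A) ∈ V n := by
    intro v hv
    obtain ⟨hvB, -⟩ := (hV (n + 1) v).mp v.2
    exact (hV n _).mpr ⟨hvB, hv⟩
  have hcard : Nat.card (V (n + 1)) = Nat.card f.ker * Nat.card f.range := by
    rw [← AddSubgroup.index_ker, AddSubgroup.card_mul_index]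
  rw [hcard]
  refine Nat.mul_le_mul ?_ ?_
  · refine Nat.card_le_card_of_injective (fun v : f.ker ↦ (⟨((v : V (n + 1)) : A),
      hf_ker _ ((AddMonoidHom.mem_ker).mp v.2)⟩ : V n)) ?_
    intro v w hvw
    apply Subtype.ext; apply Subtype.ext
    exact congrArg (fun z : V n ↦ (z : A)) hvw
  · refine Nat.card_le_card_of_injective (fun y : f.range ↦ (⟨(y : A), ?_⟩ : V 1)) ?_
    · obtain ⟨v, hv⟩ := (AddMonoidHom.mem_range).mp y.2
      rw [← hv]; exact hf_range v
    · intro y z hyz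
      apply Subtype.ext
      exact congrArg (fun z : V 1 ↦ (z : A)) hyz

/-- `#V_n ≤ p^n` for all `n` as soon as `#V_1 ≤ p` (induction on the layer bound). [folklore] -/
theorem card_layer_le_pow (hV : ∀ n x, x ∈ V n ↔ x ∈ B ∧ p ^ n • x = 0)
    (hfin : ∀ n, Finite (V n)) (h1 : Nat.card (V 1) ≤ p) (n : ℕ) : Nat.card (V n) ≤ p ^ n := by
  induction n with
  | zero =>
    haveI := hfin 0
    have hsub : Subsingleton (V 0) := by
      refine ⟨fun v w ↦ Subtype.ext ?_⟩
      have hv := ((hV 0 v).mp v.2).2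
      have hw := ((hV 0 w).mp w.2).2
      rw [pow_zero, one_smul] at hv hw
      rw [hv, hw]
    rw [pow_zero]
    exact (Nat.card_of_subsingleton (0 : V 0)).le
  | succ n ih =>
    calc Nat.card (V (n + 1)) ≤ Nat.card (V n) * Nat.card (V 1) := card_layer_succ_le hV hfin n
      _ ≤ p ^ n * p := Nat.mul_le_mul ih h1
      _ = p ^ (n + 1) := (pow_succ p n).symm

variable [hp : Fact p.Prime]

/-- **A `p`-primary group with at most `p` elements killed by `p` has cyclic layers**: if
`#V_1 ≤ p` then every `V_n = B[p^n]` is cyclic — its exponent `p^a` kills it, so `V_n ⊆ V_a` and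
`#V_n ≤ p^a = exp(V_n) ≤ #V_n`, and a finite abelian group whose exponent is its order is cyclic.
[folklore] -/
theorem isAddCyclic_layer (hV : ∀ n x, x ∈ V n ↔ x ∈ B ∧ p ^ n • x = 0)
    (hfin : ∀ n, Finite (V n)) (h1 : Nat.card (V 1) ≤ p) (n : ℕ) : IsAddCyclic (V n) := by
  haveI := hfin n
  have hprime : p.Prime := hp.out
  have hdvd : AddMonoid.exponent (V n) ∣ p ^ n := by
    rw [AddMonoid.exponent_dvd_iff_forall_nsmul_eq_zero]
    intro v
    apply Subtype.ext
    rw [AddSubmonoidClass.coe_nsmul, ZeroMemClass.coe_zero]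
    exact ((hV n v).mp v.2).2
  obtain ⟨a, -, ha⟩ := (Nat.dvd_prime_pow hprime).mp hdvd
  have hle : Nat.card (V n) ≤ Nat.card (V a) := by
    haveI := hfin a
    refine Nat.card_le_card_of_injective (fun v : V n ↦ (⟨(v : A), ?_⟩ : V a)) ?_
    · refine (hV a _).mpr ⟨((hV n v).mp v.2).1, ?_⟩
      have h := AddMonoid.exponent_nsmul_eq_zero v
      rw [ha] at h
      have h' := congrArg (fun z : V n ↦ (z : A)) h
      simpa only [AddSubmonoidClass.coe_nsmul, ZeroMemClass.coe_zero] using h'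
    · intro v w hvw
      apply Subtype.ext
      exact congrArg (fun z : V a ↦ (z : A)) hvw
  have hexp_le : Nat.card (V n) ≤ AddMonoid.exponent (V n) :=
    hle.trans ((card_layer_le_pow hV hfin h1 a).trans (le_of_eq ha.symm))
  have hexp_ge : AddMonoid.exponent (V n) ≤ Nat.card (V n) :=
    Nat.le_of_dvd Nat.card_pos (AddGroup.exponent_dvd_nat_card)
  exact IsAddCyclic.of_exponent_eq_card (le_antisymm hexp_ge hexp_le)

end PGroupCounting

/-! ## §2. On a stable cyclic subgroup any two automorphisms commute -/

section CyclicCommute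

variable {G A : Type*} [Group G] [AddCommGroup A] [DistribMulAction G A]

/-- On a `G`-stable cyclic subgroup `C` of a `G`-module every `g ∈ G` acts as multiplication by
an integer, so any two elements of `G` commute there. [folklore] -/
theorem smul_smul_comm_of_isAddCyclic (C : AddSubgroup A) (hC : ∀ g : G, ∀ a ∈ C, g • a ∈ C)
    [hcyc : IsAddCyclic C] (g h : G) {a : A} (ha : a ∈ C) : g • h • a = h • g • a := by
  obtain ⟨c, hc⟩ := hcyc.exists_zsmul_surjective
  have key : ∀ g : G, ∃ k : ℤ, ∀ a ∈ C, g • a = k • a := by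
    intro g
    obtain ⟨k, hk⟩ := hc ⟨g • (c : A), hC g _ c.2⟩
    refine ⟨k, fun a ha ↦ ?_⟩
    obtain ⟨j, hj⟩ := hc ⟨a, ha⟩
    have hj' : (j • c : C) = ⟨a, ha⟩ := hj
    have hja : j • (c : A) = a := by
      have := congrArg (fun z : C ↦ (z : A)) hj'
      simpa only [AddSubgroupClass.coe_zsmul] using this
    have hkc : k • (c : A) = g • (c : A) := by
      have := congrArg (fun z : C ↦ (z : A)) hk
      simpa only [AddSubgroupClass.coe_zsmul] using this
    rw [← hja, smul_comm g j (c : A), ← hkc, smul_comm j k (c : A)]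
  obtain ⟨kg, hkg⟩ := key g
  obtain ⟨kh, hkh⟩ := key h
  rw [hkh a ha, hkg _ (C.zsmul_mem ha kh), hkg a ha, hkh _ (C.zsmul_mem ha kg), smul_comm]

end CyclicCommute

/-! ## §3. The dihedral set-up: `Γ_K ↪ Γ_ℚ` of index two and the anticyclotomic relation -/

section Restrict

variable {K : Type} [Field K] [NumberField K] {p : ℕ} [Fact p.Prime] (κ : ZpExtension K p)

/-- For `[K : ℚ] = 2` the image of `Γ_K → Γ_ℚ` is normal: a conjugate of a restriction is a
restriction (index two, `inv_mul_mem_range_absGaloisRestrict`). [folklore] -/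
theorem exists_absGaloisRestrict_eq_conj (h2 : Module.finrank ℚ K = 2)
    (g : absoluteGaloisGroup ℚ) (σ : absoluteGaloisGroup K) :
    ∃ σ' : absoluteGaloisGroup K,
      absGaloisRestrict ℚ K σ' = g * absGaloisRestrict ℚ K σ * g⁻¹ := by
  by_cases hg : g ∈ Set.range (absGaloisRestrict ℚ K)
  · obtain ⟨η, rfl⟩ := hg
    exact ⟨η * σ * η⁻¹, by rw [map_mul, map_mul, map_inv]⟩
  · have hg' : g⁻¹ ∉ Set.range (absGaloisRestrict ℚ K) := fun ⟨η, hη⟩ ↦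
      hg ⟨η⁻¹, by rw [map_inv, hη, inv_inv]⟩
    have hσg : absGaloisRestrict ℚ K σ * g⁻¹ ∉ Set.range (absGaloisRestrict ℚ K) := by
      rintro ⟨η, hη⟩
      exact hg' ⟨σ⁻¹ * η, by rw [map_mul, map_inv, hη, inv_mul_cancel_left]⟩
    obtain ⟨σ', hσ'⟩ := inv_mul_mem_range_absGaloisRestrict h2 hg' hσg
    exact ⟨σ', by rw [hσ', inv_inv, mul_assoc]⟩

/-- The anticyclotomic relation: if `res σ' = ρ (res σ) ρ⁻¹` with `ρ ∉ Γ_K` then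
`κ σ' = (κ σ)⁻¹`, i.e. `σ' σ ∈ ker κ`. [folklore] -/
theorem mul_mem_kerSubgroup_of_isAnticyclotomic (hκ : κ.IsAnticyclotomic)
    {ρ : absoluteGaloisGroup ℚ} (hρ : ρ ∉ Set.range (absGaloisRestrict ℚ K))
    {σ σ' : absoluteGaloisGroup K}
    (h : absGaloisRestrict ℚ K σ' = ρ * absGaloisRestrict ℚ K σ * ρ⁻¹) :
    σ' * σ ∈ κ.kerSubgroup := by
  rw [ZpExtension.mem_kerSubgroup, map_mul, hκ σ σ' ρ hρ h, inv_mul_cancel]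

/-- `res(ker κ)` is normal in `Γ_ℚ` (`K_∞^{ac}/ℚ` is Galois): every `Γ_ℚ`-conjugate of `res τ`,
`τ ∈ ker κ`, is `res τ'` with `τ' ∈ ker κ` — by the abelian target on the coset `Γ_K` and by
the anticyclotomic relation off it. [folklore] -/
theorem exists_mem_kerSubgroup_absGaloisRestrict_eq_conj (h2 : Module.finrank ℚ K = 2)
    (hκ : κ.IsAnticyclotomic) (g : absoluteGaloisGroup ℚ) {τ : absoluteGaloisGroup K}
    (hτ : τ ∈ κ.kerSubgroup) :
    ∃ τ' ∈ κ.kerSubgroup, absGaloisRestrict ℚ K τ' = g * absGaloisRestrict ℚ K τ * g⁻¹ := by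
  by_cases hg : g ∈ Set.range (absGaloisRestrict ℚ K)
  · obtain ⟨η, rfl⟩ := hg
    refine ⟨η * τ * η⁻¹, ?_, by rw [map_mul, map_mul, map_inv]⟩
    rw [ZpExtension.mem_kerSubgroup] at hτ ⊢
    rw [map_mul, map_mul, map_inv, hτ, mul_one, mul_inv_cancel]
  · obtain ⟨τ', hτ'⟩ := exists_absGaloisRestrict_eq_conj h2 g τ
    refine ⟨τ', ?_, hτ'⟩
    have h := mul_mem_kerSubgroup_of_isAnticyclotomic κ hκ hg hτ'
    rw [ZpExtension.mem_kerSubgroup] at hτ h ⊢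
    rw [map_mul, hτ, mul_one] at h
    exact h

end Restrict

/-! ## §4. Over `ℚ̄`: points of `E[p^∞]` fixed by `Gal(ℚ̄/K_∞^{ac})` are fixed by `Γ_K` -/

section Rational

variable (W : WeierstrassCurve ℚ) {p : ℕ} [hp : Fact p.Prime]
  {K : Type} [Field K] [NumberField K] (κ : ZpExtension K p)

/-- `Γ_ℚ`-stability of the fixed set of `res(ker κ)`: if `P ∈ E(ℚ̄)` is fixed by `res τ` for all
`τ ∈ ker κ`, so is `g • P` for every `g ∈ Γ_ℚ` (normality of `res(ker κ)`). [folklore] -/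
theorem forall_kerSubgroup_smul_smul_eq (h2 : Module.finrank ℚ K = 2) (hκ : κ.IsAnticyclotomic)
    (g : absoluteGaloisGroup ℚ) {P : geomPoints W}
    (hP : ∀ τ ∈ κ.kerSubgroup, absGaloisRestrict ℚ K τ • P = P) :
    ∀ τ ∈ κ.kerSubgroup, absGaloisRestrict ℚ K τ • g • P = g • P := by
  intro τ hτ
  obtain ⟨τ', hτ', hres⟩ := exists_mem_kerSubgroup_absGaloisRestrict_eq_conj κ h2 hκ g⁻¹ hτ
  rw [inv_inv] at hres
  have key : absGaloisRestrict ℚ K τ = g * absGaloisRestrict ℚ K τ' * g⁻¹ := by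
    rw [hres]; group
  rw [key, mul_smul, mul_smul, inv_smul_smul, hP τ' hτ']

/-- **`p`-power order.** On a finite `Γ_ℚ`-stable set `C` of points fixed by `res(ker κ)`, the
group `Γ_K` acts through a finite quotient of `Γ_K/ker κ ≅ ℤ_p`, a `p`-group
(`ZpExtension.isPGroup_range_of_kerSubgroup_le`): for every `σ ∈ Γ_K` some `(res σ)^{p^k}` acts
trivially on `C`. [folklore] -/
theorem exists_pow_absGaloisRestrict_smul_eq (C : AddSubgroup (geomPoints W)) [Finite C]
    (hC : ∀ g : absoluteGaloisGroup ℚ, ∀ P ∈ C, g • P ∈ C)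
    (hfix : ∀ τ ∈ κ.kerSubgroup, ∀ P ∈ C, absGaloisRestrict ℚ K τ • P = P)
    (σ : absoluteGaloisGroup K) :
    ∃ k : ℕ, ∀ P ∈ C, (absGaloisRestrict ℚ K σ) ^ (p ^ k) • P = P := by
  let ρ : absoluteGaloisGroup K →* Equiv.Perm C :=
    { toFun := fun σ ↦
        { toFun := fun v ↦ ⟨absGaloisRestrict ℚ K σ • (v : geomPoints W), hC _ _ v.2⟩
          invFun := fun v ↦ ⟨(absGaloisRestrict ℚ K σ)⁻¹ • (v : geomPoints W), hC _ _ v.2⟩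
          left_inv := fun v ↦ Subtype.ext (inv_smul_smul _ (v : geomPoints W))
          right_inv := fun v ↦ Subtype.ext (smul_inv_smul _ (v : geomPoints W)) }
      map_one' := Equiv.ext fun v ↦ Subtype.ext (by
        change absGaloisRestrict ℚ K 1 • (v : geomPoints W) = v
        rw [map_one, one_smul])
      map_mul' := fun σ τ ↦ Equiv.ext fun v ↦ Subtype.ext (by
        change absGaloisRestrict ℚ K (σ * τ) • (v : geomPoints W) =
          absGaloisRestrict ℚ K σ • absGaloisRestrict ℚ K τ • (v : geomPoints W)
        rw [map_mul, mul_smul]) }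
  have hρ : ∀ (σ : absoluteGaloisGroup K) (v : C),
      ((ρ σ v : C) : geomPoints W) = absGaloisRestrict ℚ K σ • (v : geomPoints W) :=
    fun _ _ ↦ rfl
  have hker : κ.kerSubgroup ≤ ρ.ker := by
    intro τ hτ
    rw [MonoidHom.mem_ker]
    refine Equiv.ext fun v ↦ Subtype.ext ?_
    rw [hρ, Equiv.Perm.coe_one, id_eq]
    exact hfix τ hτ _ v.2
  have hP : IsPGroup p ρ.range := κ.isPGroup_range_of_kerSubgroup_le ρ hker
  obtain ⟨k, hk⟩ := hP ⟨ρ σ, ⟨σ, rfl⟩⟩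
  refine ⟨k, fun P hPC ↦ ?_⟩
  have hk' : ρ (σ ^ p ^ k) = 1 := by
    rw [map_pow]
    have := congrArg Subtype.val hk
    simpa using this
  have h : ((ρ (σ ^ p ^ k) ⟨P, hPC⟩ : C) : geomPoints W) = P := by rw [hk']; rfl
  rw [hρ, map_pow] at h
  exact h

/-- **Case A (cyclic layers).** Let `C` be a finite cyclic `Γ_ℚ`-stable subgroup of `E(ℚ̄)`
fixed pointwise by `res(ker κ)`, `κ` anticyclotomic, `K` imaginary quadratic, `p` odd. Then `Γ_K`
fixes `C` pointwise: for `σ ∈ Γ_K` and a lift `ρ₀ ∈ Γ_ℚ ∖ Γ_K` of complex conjugation, the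
element `σ'` with `res σ' = ρ₀ (res σ) ρ₀⁻¹` has `σ' σ ∈ ker κ`; on the cyclic group `C` the
actions of `ρ₀` and `res σ` commute, so `(res σ)²` acts trivially; and `res σ` acts through an
element of `p`-power order, `p` odd. [folklore] -/
theorem absGaloisRestrict_smul_eq_of_isAddCyclic (hp2 : p ≠ 2) (hK : IsImaginaryQuadratic K)
    (hκ : κ.IsAnticyclotomic) (C : AddSubgroup (geomPoints W)) [Finite C] [IsAddCyclic C]
    (hC : ∀ g : absoluteGaloisGroup ℚ, ∀ P ∈ C, g • P ∈ C)
    (hfix : ∀ τ ∈ κ.kerSubgroup, ∀ P ∈ C, absGaloisRestrict ℚ K τ • P = P)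
    (σ : absoluteGaloisGroup K) {P : geomPoints W} (hPC : P ∈ C) :
    absGaloisRestrict ℚ K σ • P = P := by
  have hprime : p.Prime := hp.out
  haveI : NumberField.IsTotallyComplex K := hK.2
  -- a lift of complex conjugation
  obtain ⟨ρ₀, hρ₀, -⟩ := exists_not_mem_range_absGaloisRestrict (K := ℚ) (L := K)
    (Rat.castHom ℝ) (fun w ↦ NumberField.IsTotallyComplex.isComplex w)
  obtain ⟨σ', hσ'⟩ := exists_absGaloisRestrict_eq_conj hK.1 ρ₀ σ
  have hmem : σ' * σ ∈ κ.kerSubgroup := mul_mem_kerSubgroup_of_isAnticyclotomic κ hκ hρ₀ hσ'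
  -- `(res σ)²` acts trivially on `C`
  have hsq : ∀ Q ∈ C, absGaloisRestrict ℚ K σ • absGaloisRestrict ℚ K σ • Q = Q := by
    intro Q hQ
    have h1 : absGaloisRestrict ℚ K σ' • absGaloisRestrict ℚ K σ • Q = Q := by
      rw [← mul_smul, ← map_mul]; exact hfix _ hmem Q hQ
    have h2 : absGaloisRestrict ℚ K σ' • absGaloisRestrict ℚ K σ • Q =
        absGaloisRestrict ℚ K σ • absGaloisRestrict ℚ K σ • Q := by
      rw [hσ', mul_smul, mul_smul,
        smul_smul_comm_of_isAddCyclic C hC (absGaloisRestrict ℚ K σ) ρ₀⁻¹ (hC _ _ hQ),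
        smul_inv_smul]
    rw [h2] at h1
    exact h1
  -- `res σ` has `p`-power order on `C`, `p` odd
  obtain ⟨k, hk⟩ := exists_pow_absGaloisRestrict_smul_eq W κ C hC hfix σ
  obtain ⟨m, hm⟩ : Odd (p ^ k) := (hprime.odd_of_ne_two hp2).pow
  have hpow : ∀ j : ℕ, ∀ Q ∈ C, (absGaloisRestrict ℚ K σ) ^ (2 * j) • Q = Q := by
    intro j
    induction j with
    | zero => intro Q _; rw [mul_zero, pow_zero, one_smul]
    | succ j ih =>
      intro Q hQ
      rw [Nat.mul_succ, pow_add, mul_smul, pow_two, mul_smul, hsq Q hQ, ih Q hQ]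
  have h := hk P hPC
  rw [hm, pow_succ, mul_smul, hpow m _ (hC _ P hPC)] at h
  exact h

end Rational

end Summit.BirchSwinnertonDyer.BirchSwinnertonDyer.Theorems.SchneiderFreeAdditiveX3

end
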